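import Mathlib.RepresentationTheory.Intertwining
import Mathlib.RepresentationTheory.Irreducible
import Literature.NumberTheory.Automorphic.SmoothRepresentation
import Literature.NumberTheory.Automorphic.MatrixCoefficients
import HarnessLib

-- provenance: harness21/H21/H21/Prelude/AutomorphicL/IrreducibleClasses.lean @ 0d9fdaa (interim HEAD d8f2665); M5 mechanical rewrite
/-!
# Isomorphism classes of irreducible smooth representations (AutomorphicL trunk, item I4 =
`G25:IrreducibleClasses`, outline D7)

For a topological group `G` (typically locally profinite) we bundle an *irreducible smooth
complex representation* as a structure `Literature.SmoothIrrep G` (carrier `V : Type` in universe `0`,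
outline H9, with its `AddCommGroup`/`Module ℂ` instances, a `Representation ℂ G V`, and proofs
of irreducibility and smoothness), put on it the setoid "there is an isomorphism of
representations" (Mathlib `Representation.Equiv`), and define the type `Literature.IrrClass G` of
isomorphism classes as the quotient. This is the set usually written `Irr(G)` or `𝒜₁(G)`,
the domain of the local Langlands correspondence.

## Main definitions

* `Literature.SmoothIrrep G`, `Literature.NumberTheory.Automorphic.SmoothIrrep.setoid`, `Literature.IrrClass G := Quotient _`,
  `Literature.NumberTheory.Automorphic.IrrClass.mk`.
* `Literature.NumberTheory.Automorphic.IrrClass.liftProp`: descend an isomorphism-invariant predicate to classes;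
  `Literature.NumberTheory.Automorphic.IrrClass.ind`: induction principle.
* `Representation.Equiv.twist`, `Representation.subrepresentationTwistOrderIso`,
  `Representation.isIrreducible_twist`, `Representation.IsSmooth.twist`: twisting by a
  character commutes with isomorphisms, preserves irreducibility, and preserves smoothness when
  the character is smooth (open kernel).
* `Literature.NumberTheory.Automorphic.SmoothIrrep.twist`, `Literature.NumberTheory.Automorphic.IrrClass.twist`: `π ↦ π ⊗ χ` for a smooth character
  `χ : G →* ℂˣ`, well defined on classes.
* `Representation.Equiv.subrepresentationOrderIso`, `Representation.Equiv.isIrreducible`,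
  `Representation.HasCentralCharacter.of_equiv`, `Representation.Equiv.comp_mem_contragredient`,
  `Representation.IsSupercuspidal.of_equiv`: irreducibility, central characters and
  supercuspidality transport along isomorphisms of representations (all proved).
* `Literature.NumberTheory.Automorphic.SmoothIrrep.HasCentralCharacter`, `Literature.NumberTheory.Automorphic.IrrClass.HasCentralCharacter`,
  `Literature.NumberTheory.Automorphic.IrrClass.IsSupercuspidal`: the corresponding predicates on `Irr(G)`.

## Mathlib declarations used rather than redefined

`Representation.Equiv` (with `refl`/`symm`/`trans`, `Equiv.mk`), `Representation.IsIrreducible`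
(`IsSimpleOrder (Subrepresentation ρ)`), `Subrepresentation`, `OrderIso.isSimpleOrder_iff`,
`Quotient`. Mathlib has no bundled "irreducible representation" type nor a type of isomorphism
classes of representations (grep `Irrep`, `IsoClass` in `RepresentationTheory/`: nothing); the
category `Rep k G` lives in a fixed universe for `V` but carries no smoothness and its
isomorphism classes are not set up as a type either.

## Design notes

* **Universe (H9).** `SmoothIrrep.V : Type`; hence `SmoothIrrep G : Type (u+1)` for
  `G : Type u` and `IrrClass G` likewise. All predicates on classes are `Prop`-valued.
* **Namespace.** `SmoothIrrep`, `IrrClass` live in `namespace Literature`. The generic facts about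
  twists and equivalences are deliberate dot-notation extensions in Mathlib's
  `namespace Representation` (`Representation.Equiv.twist`, `Representation.IsSmooth.twist`, …),
  continuing the convention of `Literature.Prelude.AutomorphicAxiomatic.SmoothRepresentation`.
* **Twists.** Twisting a smooth representation by a *discontinuous* character destroys
  smoothness, so `SmoothIrrep.twist` takes the hypothesis `IsOpen (χ.ker : Set G)` (as G19's
  `IsEssentiallyDiscreteSeries` does) and `[SeparatelyContinuousMul G]`.
* **Instances.** The bundled instances of `SmoothIrrep` are registered by
  `attribute [instance]` on the structure projections (allowed by outline §3); irreducibility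
  is exposed as the instance `SmoothIrrep.instIsIrreducible` so that Mathlib's Schur-type lemmas
  (`[ρ.IsIrreducible]`) fire on `r.ρ`.

## References

* C. J. Bushnell, G. Henniart, *The local Langlands conjecture for `GL(2)`*, Grundlehren 335
  (2006), §1 (smooth representations, `Irr(G)`), §2.6 (central character), §9.1 (twisting).
* I. N. Bernstein, A. V. Zelevinsky, *Representations of the group `GL(n, F)` where `F` is a
  non-archimedean local field*, Russian Math. Surveys 31 (1976), §2.
-/

/-! ### Generic facts: twists versus equivalences, irreducibility, smoothness -/

namespace Representation

section CommRing

variable {k G V W : Type*} [CommRing k] [Group G] [AddCommGroup V] [Module k V]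
  [AddCommGroup W] [Module k W] {ρ : Representation k G V} {σ : Representation k G W}

/-- An isomorphism of representations `ρ ≃ σ` is also an isomorphism of the twists
`ρ ⊗ χ ≃ σ ⊗ χ` (same underlying linear equivalence). (Bushnell–Henniart 2006, §9.1.) [cite: BushnellHenniart2006, §9.1] -/
def Equiv.twist (φ : ρ.Equiv σ) (χ : G →* kˣ) : (ρ.twist χ).Equiv (σ.twist χ) :=
  Equiv.mk φ.toLinearEquiv fun g => by
    ext v
    simp only [LinearMap.coe_comp, Function.comp_apply, twist_apply, map_smul]
    congr 1
    exact φ.toIntertwiningMap.isIntertwining ρ σ g v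

/-- The underlying linear equivalence of `φ.twist χ` is that of `φ`. [folklore] -/
@[simp] lemma Equiv.toLinearEquiv_twist (φ : ρ.Equiv σ) (χ : G →* kˣ) :
    (φ.twist χ).toLinearEquiv = φ.toLinearEquiv := rfl

variable (ρ) in
/-- Twisting does not change the lattice of subrepresentations: a submodule is stable under
`χ(g) • ρ(g)` iff it is stable under `ρ(g)`, since `χ(g)` is a unit.
(Bushnell–Henniart 2006, §9.1.) [cite: BushnellHenniart2006, §9.1] -/
def subrepresentationTwistOrderIso (χ : G →* kˣ) :
    Subrepresentation (ρ.twist χ) ≃o Subrepresentation ρ where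
  toFun p := ⟨p.toSubmodule, fun g v hv => by
    have h := p.apply_mem_toSubmodule g hv
    rw [twist_apply, ← Units.smul_def] at h
    exact (Submodule.smul_mem_iff' _ (χ g)).1 h⟩
  invFun q := ⟨q.toSubmodule, fun g v hv => by
    rw [twist_apply]
    exact q.toSubmodule.smul_mem _ (q.apply_mem_toSubmodule g hv)⟩
  left_inv p := by ext; rfl
  right_inv q := by ext; rfl
  map_rel_iff' := Iff.rfl

/-- A central character transports along an isomorphism of representations.
(Bushnell–Henniart 2006, §2.6.) [cite: BushnellHenniart2006, §2.6] -/
lemma HasCentralCharacter.of_equiv {ω : Subgroup.center G →* kˣ} (h : ρ.HasCentralCharacter ω)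
    (φ : ρ.Equiv σ) : σ.HasCentralCharacter ω := by
  intro z
  ext w
  have h1 := φ.toIntertwiningMap.isIntertwining ρ σ (z : G) (φ.symm w)
  rw [Equiv.coe_toIntertwiningMap, Equiv.apply_symm_apply, h.apply, map_smul,
    Equiv.apply_symm_apply] at h1
  rw [← h1]
  rfl

/-- An isomorphism of representations induces an order isomorphism of the lattices of
subrepresentations (image / preimage under the underlying linear equivalence).
(Bushnell–Henniart 2006, §1.1; folklore.) [cite: BushnellHenniart2006, §1.1] -/
def Equiv.subrepresentationOrderIso (φ : ρ.Equiv σ) :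
    Subrepresentation ρ ≃o Subrepresentation σ where
  toFun p := ⟨p.toSubmodule.map (φ.toLinearEquiv : V →ₗ[k] W), by
    rintro g w ⟨v, hv, rfl⟩
    refine ⟨ρ g v, p.apply_mem_toSubmodule g hv, ?_⟩
    change φ.toLinearEquiv (ρ g v) = σ g (φ.toLinearEquiv v)
    exact φ.toIntertwiningMap.isIntertwining ρ σ g v⟩
  invFun q := ⟨q.toSubmodule.comap (φ.toLinearEquiv : V →ₗ[k] W), by
    intro g v hv
    simp only [Submodule.mem_comap] at hv ⊢
    change φ.toIntertwiningMap (ρ g v) ∈ q.toSubmodule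
    rw [φ.toIntertwiningMap.isIntertwining ρ σ g v]
    exact q.apply_mem_toSubmodule g hv⟩
  left_inv p := by
    ext v
    change v ∈ (p.toSubmodule.map (φ.toLinearEquiv : V →ₗ[k] W)).comap
      (φ.toLinearEquiv : V →ₗ[k] W) ↔ v ∈ p.toSubmodule
    rw [Submodule.comap_map_eq_of_injective φ.toLinearEquiv.injective]
  right_inv q := by
    ext w
    change w ∈ (q.toSubmodule.comap (φ.toLinearEquiv : V →ₗ[k] W)).map
      (φ.toLinearEquiv : V →ₗ[k] W) ↔ w ∈ q.toSubmodule
    rw [Submodule.map_comap_eq_of_surjective φ.toLinearEquiv.surjective]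
  map_rel_iff' {p p'} := by
    change p.toSubmodule.map _ ≤ p'.toSubmodule.map _ ↔ p.toSubmodule ≤ p'.toSubmodule
    exact Submodule.map_le_map_iff_of_injective φ.toLinearEquiv.injective _ _

variable [TopologicalSpace G]

/-- The twist of a smooth representation by a **smooth** character (one with open kernel) is
smooth: the stabiliser of `v` in `ρ ⊗ χ` contains the open subgroup `Stab_ρ(v) ∩ ker χ`.
(Bushnell–Henniart 2006, §1.1, §9.1.) [cite: BushnellHenniart2006, §1.1  §9.1] -/
lemma IsSmooth.twist [SeparatelyContinuousMul G] (hρ : ρ.IsSmooth) {χ : G →* kˣ}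
    (hχ : IsOpen (χ.ker : Set G)) : (ρ.twist χ).IsSmooth := by
  intro v
  refine (ρ.twist χ).isSmoothVector_of_le (K := ρ.stabilizerSubgroup v ⊓ χ.ker)
    ((hρ v).inter hχ) fun g hg => ?_
  simp only [Subgroup.mem_inf, mem_stabilizerSubgroup, MonoidHom.mem_ker] at hg
  simp [twist_apply, hg.1, hg.2]

variable [SeparatelyContinuousMul G]

/-- Precomposition with an isomorphism of representations maps the smooth contragredient of `σ`
into that of `ρ`: `Stab_{ρ^∨}(ψ ∘ φ) ⊇ Stab_{σ^∨}(ψ)`. (Bushnell–Henniart 2006, §2.8.) [cite: BushnellHenniart2006, §2.8] -/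
lemma Equiv.comp_mem_contragredient (φ : ρ.Equiv σ) {ψ : Module.Dual k W}
    (hψ : ψ ∈ σ.contragredient) :
    ψ ∘ₗ (φ.toLinearEquiv : V →ₗ[k] W) ∈ ρ.contragredient := by
  rw [mem_contragredient] at hψ ⊢
  refine ρ.dual.isSmoothVector_of_le (K := σ.dual.stabilizerSubgroup ψ) hψ fun g hg => ?_
  simp only [mem_stabilizerSubgroup] at hg ⊢
  ext v
  have h1 := φ.toIntertwiningMap.isIntertwining ρ σ g⁻¹ v
  have h2 := congrArg (fun f : Module.Dual k W => f (φ.toLinearEquiv v)) hg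
  simp only [dual_apply, Module.Dual.transpose_apply, LinearMap.comp_apply] at h1 h2 ⊢
  change ψ (φ.toIntertwiningMap (ρ g⁻¹ v)) = ψ (φ.toLinearEquiv v)
  rw [h1]
  exact h2

/-- Supercuspidality transports along an isomorphism of representations (matrix coefficients
of `σ` are matrix coefficients of `ρ`: `c^{σ}_{ψ, w} = c^{ρ}_{ψ ∘ φ, φ⁻¹ w}`, and `ψ ↦ ψ ∘ φ`
maps the smooth contragredient of `σ` to that of `ρ`). (Bushnell–Henniart 2006, §10.1.) [cite: BushnellHenniart2006, §10.1] -/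
theorem IsSupercuspidal.of_equiv (h : ρ.IsSupercuspidal) (φ : ρ.Equiv σ) :
    σ.IsSupercuspidal := by
  intro ψ hψ w
  obtain ⟨C, hC, hsupp⟩ := h _ (φ.comp_mem_contragredient hψ) (φ.symm w)
  refine ⟨C, hC, ?_⟩
  convert hsupp using 2
  ext g
  simp only [matrixCoeff_apply, LinearMap.comp_apply]
  change ψ (σ g w) = ψ (φ.toIntertwiningMap (ρ g (φ.symm w)))
  rw [φ.toIntertwiningMap.isIntertwining ρ σ g, Equiv.coe_toIntertwiningMap,
    Equiv.apply_symm_apply]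

end CommRing

section Field

variable {k G V W : Type*} [Field k] [Group G] [AddCommGroup V] [Module k V]
  [AddCommGroup W] [Module k W] {ρ : Representation k G V} {σ : Representation k G W}

variable (ρ) in
/-- A twist of a representation is irreducible iff the representation is
(`subrepresentationTwistOrderIso`). (Bushnell–Henniart 2006, §9.1.) [cite: BushnellHenniart2006, §9.1] -/
lemma isIrreducible_twist_iff (χ : G →* kˣ) : (ρ.twist χ).IsIrreducible ↔ ρ.IsIrreducible :=
  (ρ.subrepresentationTwistOrderIso χ).isSimpleOrder_iff

variable (ρ) in
/-- A twist of an irreducible representation is irreducible. (Bushnell–Henniart 2006, §9.1.) [cite: BushnellHenniart2006, §9.1] -/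
lemma isIrreducible_twist [ρ.IsIrreducible] (χ : G →* kˣ) : (ρ.twist χ).IsIrreducible :=
  (ρ.isIrreducible_twist_iff χ).2 ‹_›

/-- Isomorphic representations are simultaneously irreducible (the subrepresentation
lattices are isomorphic via `Equiv.subrepresentationOrderIso`).
(Bushnell–Henniart 2006, §1.1; folklore.) [cite: BushnellHenniart2006, §1.1] -/
lemma Equiv.isIrreducible_iff (φ : ρ.Equiv σ) : ρ.IsIrreducible ↔ σ.IsIrreducible :=
  φ.subrepresentationOrderIso.isSimpleOrder_iff

/-- Irreducibility transports along an isomorphism of representations.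
(Bushnell–Henniart 2006, §1.1; folklore.) [cite: BushnellHenniart2006, §1.1] -/
lemma Equiv.isIrreducible (φ : ρ.Equiv σ) [ρ.IsIrreducible] : σ.IsIrreducible :=
  φ.isIrreducible_iff.1 ‹_›

end Field

end Representation

/-! ### Bundled irreducible smooth representations and their isomorphism classes -/

namespace Literature.NumberTheory.Automorphic

universe u

/-- An **irreducible smooth complex representation** of a topological group `G`, bundled:
a complex vector space `V` (in `Type`, outline H9), a representation `ρ : G → GL(V)`, and proofs
that `ρ` is irreducible (Mathlib `Representation.IsIrreducible`) and smooth
(`Representation.IsSmooth`). (Bushnell–Henniart 2006, §1.1–1.2, "the set `Irr(G)`".) [cite: BushnellHenniart2006, §1.1–1.2  "the set  Irr(G] -/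
structure SmoothIrrep (G : Type u) [Group G] [TopologicalSpace G] : Type (u + 1) where
  /-- The representation space. -/
  V : Type
  /-- The additive group structure on `V`. -/
  [instAddCommGroup : AddCommGroup V]
  /-- The `ℂ`-vector space structure on `V`. -/
  [instModule : Module ℂ V]
  /-- The action of `G` on `V`. -/
  ρ : Representation ℂ G V
  /-- `ρ` is irreducible. -/
  isIrreducible : ρ.IsIrreducible
  /-- `ρ` is smooth: every vector has open stabiliser. -/
  isSmooth : ρ.IsSmooth

attribute [instance] SmoothIrrep.instAddCommGroup SmoothIrrep.instModule

namespace SmoothIrrep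

variable {G : Type u} [Group G] [TopologicalSpace G]

/-- Irreducibility of a bundled irreducible smooth representation, as an instance (structure
projection). [folklore] -/
instance instIsIrreducible (r : SmoothIrrep G) : r.ρ.IsIrreducible := r.isIrreducible

/-- Two irreducible smooth representations are **isomorphic** if there is a `G`-equivariant
linear isomorphism between them (Mathlib `Representation.Equiv`); this is an equivalence
relation by `Equiv.refl/symm/trans`. (Bushnell–Henniart 2006, §1.1.) [cite: BushnellHenniart2006, §1.1] -/
instance setoid (G : Type u) [Group G] [TopologicalSpace G] : Setoid (SmoothIrrep G) where
  r r₁ r₂ := Nonempty (r₁.ρ.Equiv r₂.ρ)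
  iseqv :=
    { refl := fun r => ⟨.refl r.ρ⟩
      symm := fun ⟨e⟩ => ⟨e.symm⟩
      trans := fun ⟨e⟩ ⟨f⟩ => ⟨e.trans f⟩ }

/-- Unfolding lemma for the isomorphism setoid. [folklore] -/
lemma equiv_iff (r₁ r₂ : SmoothIrrep G) : r₁ ≈ r₂ ↔ Nonempty (r₁.ρ.Equiv r₂.ρ) := Iff.rfl

/-- The **twist** `π ⊗ χ` of an irreducible smooth representation by a smooth character
`χ : G →* ℂˣ` (open kernel): same space, action `g ↦ χ(g) ρ(g)`; irreducible by
`Representation.isIrreducible_twist`, smooth by `Representation.IsSmooth.twist`.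
(Bushnell–Henniart 2006, §9.1; for `GL_n(F)` one takes `χ = χ₀ ∘ det`.) [cite: BushnellHenniart2006, §9.1] -/
def twist [SeparatelyContinuousMul G] (r : SmoothIrrep G) (χ : G →* ℂˣ)
    (hχ : IsOpen (χ.ker : Set G)) : SmoothIrrep G where
  V := r.V
  ρ := r.ρ.twist χ
  isIrreducible := r.ρ.isIrreducible_twist χ
  isSmooth := r.isSmooth.twist hχ

/-- The representation underlying a twist. [folklore] -/
@[simp] lemma ρ_twist [SeparatelyContinuousMul G] (r : SmoothIrrep G) (χ : G →* ℂˣ)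
    (hχ : IsOpen (χ.ker : Set G)) : (r.twist χ hχ).ρ = r.ρ.twist χ := rfl

/-- Twisting respects isomorphism (`Representation.Equiv.twist`). [folklore] -/
lemma twist_equiv_twist [SeparatelyContinuousMul G] {r₁ r₂ : SmoothIrrep G} (h : r₁ ≈ r₂)
    (χ : G →* ℂˣ) (hχ : IsOpen (χ.ker : Set G)) : r₁.twist χ hχ ≈ r₂.twist χ hχ :=
  h.elim fun e => ⟨e.twist χ⟩

/-- `r` has **central character** `ω : Z(G) →* ℂˣ` if every central `z` acts on `r.V` as the
scalar `ω z` (G19 `Representation.HasCentralCharacter`). (Bushnell–Henniart 2006, §2.6.) [cite: BushnellHenniart2006, §2.6] -/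
def HasCentralCharacter (r : SmoothIrrep G) (ω : Subgroup.center G →* ℂˣ) : Prop :=
  r.ρ.HasCentralCharacter ω

/-- Unfolding lemma for `SmoothIrrep.HasCentralCharacter`. [folklore] -/
lemma hasCentralCharacter_iff (r : SmoothIrrep G) (ω : Subgroup.center G →* ℂˣ) :
    r.HasCentralCharacter ω ↔ r.ρ.HasCentralCharacter ω := Iff.rfl

end SmoothIrrep

/-- The set `Irr(G)` of **isomorphism classes of irreducible smooth complex representations**
of `G`: the quotient of `SmoothIrrep G` by isomorphism of representations.
(Bushnell–Henniart 2006, §1.1–1.2.) [cite: BushnellHenniart2006, §1.1–1.2] -/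
def IrrClass (G : Type u) [Group G] [TopologicalSpace G] : Type (u + 1) :=
  Quotient (SmoothIrrep.setoid G)

namespace IrrClass

variable {G : Type u} [Group G] [TopologicalSpace G]

/-- The isomorphism class `[π]` of an irreducible smooth representation `π`. [folklore] -/
def mk (r : SmoothIrrep G) : IrrClass G := Quotient.mk _ r

/-- Two representations have the same class iff they are isomorphic. [folklore] -/
lemma mk_eq_mk_iff (r₁ r₂ : SmoothIrrep G) : mk r₁ = mk r₂ ↔ Nonempty (r₁.ρ.Equiv r₂.ρ) :=
  Quotient.eq

/-- Isomorphic representations have the same class. [folklore] -/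
lemma mk_eq_mk_of_equiv {r₁ r₂ : SmoothIrrep G} (e : r₁.ρ.Equiv r₂.ρ) : mk r₁ = mk r₂ :=
  Quotient.sound ⟨e⟩

/-- Every class is the class of some representation. [folklore] -/
lemma mk_surjective : Function.Surjective (mk : SmoothIrrep G → IrrClass G) :=
  Quotient.mk_surjective

/-- **Induction principle** for `IrrClass`: to prove a property of all classes it suffices to
prove it for classes of representatives. [folklore] -/
@[elab_as_elim]
protected lemma ind {P : IrrClass G → Prop} (h : ∀ r : SmoothIrrep G, P (mk r))
    (c : IrrClass G) : P c :=
  Quotient.ind h c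

/-- Descend a predicate on representations to isomorphism classes, given that it is invariant
under isomorphism of representations (one direction suffices, by symmetry of `Equiv`). This is
the helper through which `IsSupercuspidal`, `HasCentralCharacter`, genericity, … are defined on
`Irr(G)`. [folklore] -/
def liftProp (P : SmoothIrrep G → Prop)
    (hP : ∀ r₁ r₂ : SmoothIrrep G, r₁.ρ.Equiv r₂.ρ → P r₁ → P r₂) : IrrClass G → Prop :=
  Quotient.lift P fun r₁ r₂ h => h.elim fun e => propext ⟨hP r₁ r₂ e, hP r₂ r₁ e.symm⟩

/-- Computation rule for `liftProp` on a class `[r]`. [folklore] -/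
@[simp] lemma liftProp_mk (P : SmoothIrrep G → Prop)
    (hP : ∀ r₁ r₂ : SmoothIrrep G, r₁.ρ.Equiv r₂.ρ → P r₁ → P r₂) (r : SmoothIrrep G) :
    liftProp P hP (mk r) ↔ P r := Iff.rfl

/-- The **twist** `[π] ↦ [π ⊗ χ]` of isomorphism classes by a smooth character `χ : G →* ℂˣ`;
well defined by `SmoothIrrep.twist_equiv_twist`. (Bushnell–Henniart 2006, §9.1.) [cite: BushnellHenniart2006, §9.1] -/
def twist [SeparatelyContinuousMul G] (χ : G →* ℂˣ) (hχ : IsOpen (χ.ker : Set G)) :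
    IrrClass G → IrrClass G :=
  Quotient.map (fun r => r.twist χ hχ) fun _ _ h => SmoothIrrep.twist_equiv_twist h χ hχ

/-- Computation rule for `IrrClass.twist` on a class `[r]`. [folklore] -/
@[simp] lemma twist_mk [SeparatelyContinuousMul G] (χ : G →* ℂˣ) (hχ : IsOpen (χ.ker : Set G))
    (r : SmoothIrrep G) : twist χ hχ (mk r) = mk (r.twist χ hχ) := rfl

/-- A class `[π]` has **central character** `ω` if (any, equivalently every) representative
does (`Representation.HasCentralCharacter.of_equiv`). (Bushnell–Henniart 2006, §2.6.) [cite: BushnellHenniart2006, §2.6] -/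
def HasCentralCharacter (c : IrrClass G) (ω : Subgroup.center G →* ℂˣ) : Prop :=
  liftProp (fun r => r.HasCentralCharacter ω) (fun _ _ e h => h.of_equiv e) c

/-- Computation rule for `IrrClass.HasCentralCharacter` on a class `[r]`. [folklore] -/
@[simp] lemma hasCentralCharacter_mk (r : SmoothIrrep G) (ω : Subgroup.center G →* ℂˣ) :
    (mk r).HasCentralCharacter ω ↔ r.ρ.HasCentralCharacter ω := Iff.rfl

/-- A class `[π]` is **supercuspidal** if (any, equivalently every) representative is
(G19 `Representation.IsSupercuspidal`, invariance `Representation.IsSupercuspidal.of_equiv`).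
(Bushnell–Henniart 2006, §10.1.) [cite: BushnellHenniart2006, §10.1] -/
def IsSupercuspidal [SeparatelyContinuousMul G] (c : IrrClass G) : Prop :=
  liftProp (fun r => r.ρ.IsSupercuspidal) (fun _ _ e h => h.of_equiv e) c

/-- Computation rule for `IrrClass.IsSupercuspidal` on a class `[r]`. [folklore] -/
@[simp] lemma isSupercuspidal_mk [SeparatelyContinuousMul G] (r : SmoothIrrep G) :
    (mk r).IsSupercuspidal ↔ r.ρ.IsSupercuspidal := Iff.rfl

end IrrClass

end Literature.NumberTheory.Automorphic
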